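import Summits.ValiantsHypothesis.ValiantsHypothesis.Theorems.Depth4HomFourRung
import Summits.ValiantsHypothesis.ValiantsHypothesis.Theorems.SuccinctLiftSmlAnyFieldDet
import HarnessLib

/-!
# Depth4 — the det twin of rung one: the door currency's rung one is VP-saturated, over any field
# (support for crux `Depth4HomFour` = item `stmt-ValiantsHypothesis-11333`; lens 4, g29, O22-B)

Rung one of the door currency (generation 28, `Depth4HomFourRung.homDepthFour_perPoly_io`) says:
for all `a m₀` some `n ≥ m₀` has `(n+2)^a < homDepthFourCircuitSize (perPoly (Fin n) ℂ)` (GATES of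
homogeneous `ΣΠΣΠ` circuits of unbounded fan-in).  This file proves the SAME statement for the
determinant, over ANY field `K` (`homDepthFour_detPoly_io_anyField`; over `ℂ`:
`homDepthFour_detPoly_io`), and records the pair (`rungOne_per_and_det`): `per` (VNP-complete)
and `det` (in `VP`) obey the same rung, so rung one separates nothing — the census clause
«IMM / det obey the same bound» (C1.rung_ladder.proved ‖ v40) is now a kernel theorem for `det`.

Chain, all BY NAME: the any-field triple-log theorem `not_detEasyOver_anyField` (succinct-lift
files; Limaye–Srinivasan–Tavenas / Forbes any-field constant-depth bound for `IMM` + `IMM ≤_p det`)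
at `p = 0` gives `detHardConstDepth` (no `∃ c ∀ n` family of product-depth-`≤ Δ₀` circuits with
`≤ n^c + c` wires for `det_n`); the threshold absorption of
`DefinabilityGapK1ConstDepthRung.perHard_io` (textual twin, `det` for `per`) gives `detHard_io`;
generation 28's wire rebuild `exists_productDepth_two_of_homDepthFour` + `rung_arith` +
`detPoly_isHomogeneous` turn a homogeneous `ΣΠΣΠ` circuit of `≤ (n+2)^a` gates for `det_n` into a
product-depth-`2` circuit of `≤ n^(6a+24)` wires, contradiction.

HONEST GRADE.  Mathematics KNOWN (constant-depth lower bounds for `det` over any field are in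
print and in the tree); kernel-new as a statement about `homDepthFourCircuitSize (detPoly …)`;
honesty value only: rung one of crux `Depth4HomFour`'s currency is VP-SATURATED in the kernel (it
holds for a `VP` family), hence carries no information towards `VP ≠ VNP`.  NOT a rung;
0 S-currency; closes no item; helper of `stmt-ValiantsHypothesis-11333`; `Depth4HomFour`,
`VP ≠ VNP` untouched.  No `def`; every proof complete.
[cite: LimayeSrinivasanTavenas2025, Cor. 4] [cite: KumarSaraf2017, §3]
[cite: Burgisser2024Completeness, Thm. 2.20]
-/

set_option linter.dupNamespace false

noncomputable section

open MvPolynomial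
open Literature.Computability.AlgebraicComplexity
open Summit.ValiantsHypothesis.ValiantsHypothesis.Theorems.SuccinctLiftTwoNonUnit (DetEasyOver)
open Summit.ValiantsHypothesis.ValiantsHypothesis.Theorems.SuccinctLiftSmlAnyFieldDet
  (not_detEasyOver_anyField)
open Summit.ValiantsHypothesis.ValiantsHypothesis.Theorems.Depth4HomFourRung
  (exists_productDepth_two_of_homDepthFour exists_circuit_of_homDepthFourCircuitSize_le rung_arith
    homDepthFour_perPoly_io)

namespace Summit.ValiantsHypothesis.ValiantsHypothesis.Theorems.Depth4HomFourRungDet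

/-- **`det` is hard at every constant product-depth, over any field** — the `p = 0` instance of the
any-field triple-log theorem `not_detEasyOver_anyField`. [cite: LimayeSrinivasanTavenas2025, Cor. 4]
[cite: Burgisser2024Completeness, Thm. 2.20] -/
theorem detHardConstDepth (K : Type) [Field K] (Δ₀ : ℕ) : ¬ DetEasyOver K (fun _ => Δ₀) := by
  simpa using not_detEasyOver_anyField K (p := 0) (q := 1) (by norm_num) Δ₀

/-- **`det` is hard at every constant product-depth, infinitely often past any threshold** (the
finitely many `n < m₀` absorbed into the constant, as in `perHard_io`).
[cite: LimayeSrinivasanTavenas2025, Cor. 4] -/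
theorem detHard_io (K : Type) [Field K] {Δ₁ : ℕ} (hΔ₁ : 1 ≤ Δ₁) (c m₀ : ℕ) :
    ∃ n, m₀ ≤ n ∧ ∀ Γ : ArithCircuit K (Fin n × Fin n), Γ.Computes (detPoly (Fin n) K) →
      Γ.productDepth ≤ Δ₁ → n ^ c + c < Γ.edgeSize := by
  classical
  by_contra hcon
  push Not at hcon
  have hsmall : ∀ n : ℕ, ∃ Γ : ArithCircuit K (Fin n × Fin n), Γ.Computes (detPoly (Fin n) K) ∧
      Γ.productDepth ≤ Δ₁ := fun n => by
    obtain ⟨P, -, hP, hd⟩ := ArithCircuit.exists_computes_productDepth_one_holds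
      (k := K) (σ := Fin n × Fin n) (detPoly (Fin n) K)
    exact ⟨P, hP, hd.trans hΔ₁⟩
  choose C₀ hC₀c hC₀d using hsmall
  set B : ℕ := (Finset.range m₀).sup fun n => (C₀ n).edgeSize with hB
  have key : ∃ c' : ℕ, ∀ n : ℕ, ∃ C : ArithCircuit K (Fin n × Fin n),
      C.Computes (detPoly (Fin n) K) ∧ C.productDepth ≤ Δ₁ ∧ C.edgeSize ≤ n ^ c' + c' := by
    refine ⟨c + B + 1, fun n => ?_⟩
    by_cases hn : m₀ ≤ n
    · obtain ⟨Γ, hCc, hCd, hCe⟩ := hcon n hn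
      refine ⟨Γ, hCc, hCd, hCe.trans ?_⟩
      rcases Nat.eq_zero_or_pos n with rfl | hpos
      · have h0 : (0 : ℕ) ^ c ≤ 1 := by
          rcases Nat.eq_zero_or_pos c with rfl | hc
          · simp
          · rw [zero_pow (by omega)]; exact Nat.zero_le _
        omega
      · have h1 : n ^ c ≤ n ^ (c + B + 1) := Nat.pow_le_pow_right hpos (by omega)
        omega
    · push Not at hn
      refine ⟨C₀ n, hC₀c n, hC₀d n, ?_⟩
      have hle : (C₀ n).edgeSize ≤ B :=
        Finset.le_sup (f := fun n => (C₀ n).edgeSize) (Finset.mem_range.2 hn)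
      omega
  exact detHardConstDepth K Δ₁ key

/-- **Rung one in the door's currency for `det`, over any field**: for all `a m₀` some `n ≥ m₀` has
`(n+2)^a < homDepthFourCircuitSize (det_n)` (GATES of homogeneous `ΣΠΣΠ` circuits): `detHard_io` at
product-depth `2`, exponent `6a+24`, threshold `max m₀ 2`, through generation 28's wire rebuild.
[cite: LimayeSrinivasanTavenas2025, Cor. 4] [cite: KumarSaraf2017, §3] -/
theorem homDepthFour_detPoly_io_anyField (K : Type) [Field K] (a m₀ : ℕ) :
    ∃ n, m₀ ≤ n ∧ (n + 2 : ℕ∞) ^ a < homDepthFourCircuitSize (detPoly (Fin n) K) := by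
  classical
  obtain ⟨n, hn, hhard⟩ := detHard_io K (Δ₁ := 2) one_le_two (6 * a + 24) (max m₀ 2)
  have hn2 : 2 ≤ n := (le_max_right _ _).trans hn
  refine ⟨n, (le_max_left _ _).trans hn, lt_of_not_ge fun hlt => ?_⟩
  have hle : homDepthFourCircuitSize (detPoly (Fin n) K) ≤ (((n + 2) ^ a : ℕ) : ℕ∞) := by
    exact_mod_cast hlt
  obtain ⟨P, hPc, hP4, hPh, hPs⟩ := exists_circuit_of_homDepthFourCircuitSize_le hle
  have hdet : (detPoly (Fin n) K).IsHomogeneous n := by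
    simpa using detPoly_isHomogeneous (n := Fin n) (k := K)
  obtain ⟨C, hCc, hCd, hCe⟩ := exists_productDepth_two_of_homDepthFour hPc hP4 hPh hdet hn2
  have hcard : Fintype.card (Fin n × Fin n) = n * n := by simp
  rw [hcard] at hCe
  exact lt_irrefl _ (lt_of_le_of_lt (Nat.le_add_right _ _)
    ((hhard C hCc hCd).trans_le (hCe.trans (rung_arith hn2 hPs))))

/-- **The det twin of rung one** (`Depth4HomFourRung.homDepthFour_perPoly_io` with `det` for
`per`): rung one of crux `Depth4HomFour`'s currency is VP-saturated.
[cite: LimayeSrinivasanTavenas2025, Cor. 4] [cite: KumarSaraf2017, §3] -/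
theorem homDepthFour_detPoly_io (a m₀ : ℕ) :
    ∃ n, m₀ ≤ n ∧ ((n + 2 : ℕ∞) ^ a) < homDepthFourCircuitSize (detPoly (Fin n) ℂ) :=
  homDepthFour_detPoly_io_anyField ℂ a m₀

/-- Binder shape of `Depth4HomFour` at constant slope, for `det`.
[cite: LimayeSrinivasanTavenas2025, Cor. 4] -/
theorem homDepthFour_detPoly_gt_pow (a : ℕ) :
    ∃ n : ℕ, (n + 2 : ℕ∞) ^ a < homDepthFourCircuitSize (detPoly (Fin n) ℂ) :=
  (homDepthFour_detPoly_io a 0).imp fun _ h => h.2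

/-- **VP-saturation of rung one, recorded**: `per` (VNP-complete) and `det` (in `VP`) obey the
SAME door-currency rung one — so rung one separates nothing.
[cite: LimayeSrinivasanTavenas2025, Cor. 4] -/
theorem rungOne_per_and_det (a m₀ : ℕ) :
    (∃ n, m₀ ≤ n ∧ (n + 2 : ℕ∞) ^ a < homDepthFourCircuitSize (perPoly (Fin n) ℂ)) ∧
      (∃ n, m₀ ≤ n ∧ (n + 2 : ℕ∞) ^ a < homDepthFourCircuitSize (detPoly (Fin n) ℂ)) :=
  ⟨homDepthFour_perPoly_io a m₀, homDepthFour_detPoly_io a m₀⟩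

end Summit.ValiantsHypothesis.ValiantsHypothesis.Theorems.Depth4HomFourRungDet

end
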